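import Literature.Computability.Complexity.ComputableReal
import Mathlib.Algebra.BigOperators.Intervals
import Mathlib.Algebra.Order.BigOperators.Group.Finset
import HarnessLib

/-!
# Closure properties of the Kalmár elementary functions

`Literature.Computability.Complexity.ElementaryRec` (file `ComputableReal.lean`) is the class of Kalmár
elementary functions `ℕ → ℕ` in the unary-with-`Nat.pair` style of Mathlib's `Nat.Primrec`: the closure of
zero, successor, the unpairing projections, `+`, `∸`, `·` under pairing, composition, bounded sums and
bounded products (Kalmár 1943; Rose, *Subrecursion* (1984), Ch. 1; Yoshinaga, arXiv:0805.0349, Def. 6;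
Tent–Ziegler, Münster J. Math. 3 (2010), §2, "good classes").  That file only records the inclusion in the
primitive recursive functions.  This file provides the working API needed to *use* the class, following
the list of examples in Yoshinaga 2008, Example 7 and Tent–Ziegler 2010, §2:

* `ElementaryRec.of_eq`, `const`, `id`, pointwise `add'`, `mul'`, `tsub'`, `succ'`, `max'`, `min'`;
* indicator functions of `≤`, `<`, `=` and their Boolean combinations, definition by cases
  (`ite_le`, `ite_lt`, `ite_eq`, `ite_not`, `ite_and`, `ite_or`, `ite_val`) — Yoshinaga Ex. 7 (2)–(4);
* bounded sums / products / counting in functional form (`sum_range`, `prod_range`,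
  `card_filter_range`) — the defining closure operations;
* the quotient `⌊x / (y+1)⌋` by Yoshinaga's counting formula (Ex. 7 (5)), hence `div'`, `mod'`, and powers
  `pow`, `pow'` (a bounded product).

Everything here is a proved theorem about the existing inductive predicate; no definitions are introduced.

## References

* L. Kalmár, *Egyszerű példa eldönthetetlen aritmetikai problémára*, Mat. Fiz. Lapok 50 (1943), 1–23.
* H. E. Rose, *Subrecursion: functions and hierarchies*, Oxford Logic Guides 9 (1984), Ch. 1.
* M. Yoshinaga, *Periods and elementary real numbers*, arXiv:0805.0349 (2008), §2.2, Def. 6, Example 7.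
* K. Tent, M. Ziegler, *Computable functions of reals*, Münster J. Math. 3 (2010), 43–66, §2.
-/

namespace Literature.Computability.Complexity

open Finset

namespace ElementaryRec

variable {f g : ℕ → ℕ}

/-- Extensionality transport for `ElementaryRec`. [folklore] -/
theorem of_eq (hf : ElementaryRec f) (H : ∀ n, f n = g n) : ElementaryRec g :=
  (funext H : f = g) ▸ hf

/-- Constant functions are elementary (iterate the successor on zero; Yoshinaga 2008, Ex. 7 (1)).
[cite: Yoshinaga2008, Example 7 (1)] -/
theorem const : ∀ c : ℕ, ElementaryRec fun _ => c
  | 0 => zero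
  | c + 1 => (succ.comp (const c)).of_eq fun _ => rfl

/-- The identity function is elementary (pair the two unpairing projections; Yoshinaga 2008, Ex. 7 (1)).
[cite: Yoshinaga2008, Example 7 (1)] -/
protected theorem id : ElementaryRec id :=
  (left.pair right).of_eq fun n => by simp

/-- The identity function is elementary, lambda form. [folklore] -/
theorem id' : ElementaryRec fun n => n :=
  ElementaryRec.id

/-- A binary elementary operation (in `Nat.unpaired` form) applied pointwise to two elementary functions
is elementary (composition with pairing). [folklore] -/
theorem unpaired_comp {op : ℕ → ℕ → ℕ} (hop : ElementaryRec (Nat.unpaired op))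
    (hf : ElementaryRec f) (hg : ElementaryRec g) : ElementaryRec fun n => op (f n) (g n) :=
  (hop.comp (hf.pair hg)).of_eq fun n => by simp

/-- Pointwise sum of elementary functions. [folklore] -/
theorem add' (hf : ElementaryRec f) (hg : ElementaryRec g) : ElementaryRec fun n => f n + g n :=
  unpaired_comp add hf hg

/-- Pointwise product of elementary functions. [folklore] -/
theorem mul' (hf : ElementaryRec f) (hg : ElementaryRec g) : ElementaryRec fun n => f n * g n :=
  unpaired_comp mul hf hg

/-- Pointwise truncated difference of elementary functions. [folklore] -/
theorem tsub' (hf : ElementaryRec f) (hg : ElementaryRec g) : ElementaryRec fun n => f n - g n :=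
  unpaired_comp tsub hf hg

/-- Successor of an elementary function. [folklore] -/
theorem succ' (hf : ElementaryRec f) : ElementaryRec fun n => f n + 1 :=
  succ.comp hf

/-- The predecessor `n ↦ n ∸ 1` is elementary. [folklore] -/
theorem pred : ElementaryRec fun n => n - 1 :=
  tsub' id' (const 1)

/-- Pointwise maximum of elementary functions: `max a b = a + (b ∸ a)`. [folklore] -/
theorem max' (hf : ElementaryRec f) (hg : ElementaryRec g) : ElementaryRec fun n => max (f n) (g n) :=
  (add' hf (tsub' hg hf)).of_eq fun n => by omega

/-- Pointwise minimum of elementary functions: `min a b = a ∸ (a ∸ b)`. [folklore] -/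
theorem min' (hf : ElementaryRec f) (hg : ElementaryRec g) : ElementaryRec fun n => min (f n) (g n) :=
  (tsub' hf (tsub' hf hg)).of_eq fun n => by omega

/-! ### Indicator functions of elementary predicates (Yoshinaga 2008, Ex. 7 (2)–(4)) -/

/-- The indicator of `f n ≤ g n` is elementary: it equals `1 ∸ (f n ∸ g n)`.
[cite: Yoshinaga2008, Example 7 (4)] -/
theorem ite_le (hf : ElementaryRec f) (hg : ElementaryRec g) :
    ElementaryRec fun n => if f n ≤ g n then 1 else 0 :=
  (tsub' (const 1) (tsub' hf hg)).of_eq fun n => by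
    by_cases h : f n ≤ g n
    · simp [h]
    · simp [h]; omega

/-- The indicator of `f n < g n` is elementary. [cite: Yoshinaga2008, Example 7 (4)] -/
theorem ite_lt (hf : ElementaryRec f) (hg : ElementaryRec g) :
    ElementaryRec fun n => if f n < g n then 1 else 0 :=
  (ite_le (succ' hf) hg).of_eq fun n => by
    by_cases h : f n < g n <;> simp [h]

/-- The indicator of `f n = g n` is elementary. [cite: Yoshinaga2008, Example 7 (4)] -/
theorem ite_eq (hf : ElementaryRec f) (hg : ElementaryRec g) :
    ElementaryRec fun n => if f n = g n then 1 else 0 :=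
  (mul' (ite_le hf hg) (ite_le hg hf)).of_eq fun n => by
    by_cases h : f n = g n
    · simp [h]
    · by_cases h' : f n ≤ g n
      · have : ¬ g n ≤ f n := fun h'' => h (le_antisymm h' h'')
        simp [h, h', this]
      · simp [h, h']

/-- Elementary predicates are closed under negation (`1 ∸ χ`). [cite: Yoshinaga2008, Example 7 (3)] -/
theorem ite_not {p : ℕ → Prop} [DecidablePred p] (hp : ElementaryRec fun n => if p n then 1 else 0) :
    ElementaryRec fun n => if ¬ p n then 1 else 0 :=
  (tsub' (const 1) hp).of_eq fun n => by by_cases h : p n <;> simp [h]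

/-- Elementary predicates are closed under conjunction (product of indicators).
[cite: Yoshinaga2008, Example 7 (3)] -/
theorem ite_and {p q : ℕ → Prop} [DecidablePred p] [DecidablePred q]
    (hp : ElementaryRec fun n => if p n then 1 else 0) (hq : ElementaryRec fun n => if q n then 1 else 0) :
    ElementaryRec fun n => if p n ∧ q n then 1 else 0 :=
  (mul' hp hq).of_eq fun n => by by_cases h : p n <;> by_cases h' : q n <;> simp [h, h']

/-- Elementary predicates are closed under disjunction. [cite: Yoshinaga2008, Example 7 (3)] -/
theorem ite_or {p q : ℕ → Prop} [DecidablePred p] [DecidablePred q]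
    (hp : ElementaryRec fun n => if p n then 1 else 0) (hq : ElementaryRec fun n => if q n then 1 else 0) :
    ElementaryRec fun n => if p n ∨ q n then 1 else 0 :=
  (ite_not (ite_and (ite_not hp) (ite_not hq))).of_eq fun n => by
    by_cases h : p n <;> by_cases h' : q n <;> simp [h, h']

/-- Definition by cases along an elementary predicate: `χ · f + (1 ∸ χ) · g`. [folklore] -/
theorem ite_val {p : ℕ → Prop} [DecidablePred p] (hp : ElementaryRec fun n => if p n then 1 else 0)
    (hf : ElementaryRec f) (hg : ElementaryRec g) :
    ElementaryRec fun n => if p n then f n else g n :=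
  (add' (mul' hp hf) (mul' (ite_not hp) hg)).of_eq fun n => by by_cases h : p n <;> simp [h]

/-! ### Bounded sums, products and counting in functional form -/

/-- Bounded summation in functional form: if `(n, i) ↦ h n i` is elementary (as a function of the code
`Nat.pair n i`) and `b` is elementary, then `n ↦ ∑ i < b n, h n i` is elementary.
[cite: Yoshinaga2008, Definition 6 (3)] -/
theorem sum_range {h : ℕ → ℕ → ℕ} {b : ℕ → ℕ} (hh : ElementaryRec (Nat.unpaired h))
    (hb : ElementaryRec b) : ElementaryRec fun n => ∑ i ∈ range (b n), h n i :=
  ((boundedSum hh).comp (ElementaryRec.id.pair hb)).of_eq fun n => by simp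

/-- Bounded product in functional form. [cite: Yoshinaga2008, Definition 6 (3)] -/
theorem prod_range {h : ℕ → ℕ → ℕ} {b : ℕ → ℕ} (hh : ElementaryRec (Nat.unpaired h))
    (hb : ElementaryRec b) : ElementaryRec fun n => ∏ i ∈ range (b n), h n i :=
  ((boundedProd hh).comp (ElementaryRec.id.pair hb)).of_eq fun n => by simp

/-- Bounded counting: the number of `i < b n` satisfying an elementary predicate `p n i` is an elementary
function of `n` (a bounded sum of indicators). [cite: TentZiegler2010, §2] -/
theorem card_filter_range {p : ℕ → ℕ → Prop} [∀ n, DecidablePred (p n)] {b : ℕ → ℕ}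
    (hp : ElementaryRec (Nat.unpaired fun n i => if p n i then 1 else 0)) (hb : ElementaryRec b) :
    ElementaryRec fun n => ((range (b n)).filter (p n)).card :=
  (sum_range hp hb).of_eq fun n => by rw [Finset.card_filter]

/-! ### Quotient, remainder and powers (Yoshinaga 2008, Ex. 7 (1), (5)) -/

/-- Yoshinaga's counting formula for the quotient: `#{i ≤ x : i (y+1) ≤ x} = ⌊x/(y+1)⌋ + 1`.
[cite: Yoshinaga2008, Example 7 (5)] -/
theorem card_filter_mul_succ_le (x y : ℕ) :
    ((range (x + 1)).filter (fun i => i * (y + 1) ≤ x)).card = x / (y + 1) + 1 := by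
  have h : (range (x + 1)).filter (fun i => i * (y + 1) ≤ x) = range (x / (y + 1) + 1) := by
    ext i
    simp only [mem_filter, mem_range, Nat.lt_succ_iff]
    constructor
    · rintro ⟨-, hi⟩
      exact (Nat.le_div_iff_mul_le (Nat.succ_pos y)).2 hi
    · intro hi
      exact ⟨le_trans hi (Nat.div_le_self _ _), (Nat.le_div_iff_mul_le (Nat.succ_pos y)).1 hi⟩
  rw [h, card_range]

/-- The quotient `(x, y) ↦ ⌊x / (y+1)⌋` is elementary: it is `(∑_{i ≤ x} [i (y+1) ≤ x]) ∸ 1`.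
[cite: Yoshinaga2008, Example 7 (5)] -/
theorem div_succ : ElementaryRec (Nat.unpaired fun x y => x / (y + 1)) := by
  have h1 : ElementaryRec fun c : ℕ =>
      ((range (c.unpair.1 + 1)).filter (fun i => i * (c.unpair.2 + 1) ≤ c.unpair.1)).card := by
    refine card_filter_range (p := fun c i => i * (c.unpair.2 + 1) ≤ c.unpair.1)
      (b := fun c => c.unpair.1 + 1) ?_ (succ' left)
    exact (ite_le (mul' right (succ' (right.comp left))) (left.comp left)).of_eq fun c => by simp
  exact (tsub' h1 (const 1)).of_eq fun c => by simp [card_filter_mul_succ_le]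

/-- Pointwise quotient of elementary functions (with Lean's convention `x / 0 = 0`). [folklore] -/
theorem div' (hf : ElementaryRec f) (hg : ElementaryRec g) : ElementaryRec fun n => f n / g n :=
  (ite_val (p := fun n => g n = 0) (ite_eq hg (const 0)) (const 0)
    (unpaired_comp div_succ hf (tsub' hg (const 1)))).of_eq fun n => by
    rcases Nat.eq_zero_or_pos (g n) with h | h
    · simp [h]
    · simp [h.ne', Nat.sub_add_cancel h]

/-- Pointwise remainder of elementary functions: `x % y = x ∸ y ⌊x/y⌋`. [folklore] -/
theorem mod' (hf : ElementaryRec f) (hg : ElementaryRec g) : ElementaryRec fun n => f n % g n :=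
  (tsub' hf (mul' hg (div' hf hg))).of_eq fun n => by
    have := Nat.div_add_mod (f n) (g n)
    omega

/-- Exponentiation `(x, y) ↦ x ^ y` is elementary: a bounded product of the constant family `x`.
[cite: Yoshinaga2008, Example 7 (1)] -/
theorem pow : ElementaryRec (Nat.unpaired (· ^ ·)) :=
  (boundedProd left).of_eq fun n => by simp [Finset.prod_const, card_range]

/-- Pointwise powers of elementary functions. [cite: Yoshinaga2008, Example 7 (1)] -/
theorem pow' (hf : ElementaryRec f) (hg : ElementaryRec g) : ElementaryRec fun n => f n ^ g n :=
  unpaired_comp pow hf hg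

/-- Digit extraction `n ↦ (f n / g n ^ i) % g n` (the `i`-th digit of `f n` in base `g n`) is elementary.
[folklore] -/
theorem digit (hf : ElementaryRec f) (hg : ElementaryRec g) (i : ℕ) :
    ElementaryRec fun n => f n / g n ^ i % g n :=
  mod' (div' hf (pow' hg (const i))) hg

end ElementaryRec

end Literature.Computability.Complexity
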